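import Mathlib
import HarnessLib
import Literature.NumberTheory.Sieve.PretentiousDistance

/-!
# Sketch — first lemmas of the crux idea cards for `TupleElliott` (stmt-Parity-14832), ideator 3, round 1

Nothing here is proved; each `def … : Prop` is the "First lemma" / transfer target of one card and must
only elaborate over existing declarations.
-/

namespace Summit.Parity.GeneralizedHardyLittlewood.Cruxes.TupleElliott.Sketch

open scoped BigOperators
open Finset

-- crux decl (route file, closed 2026-08-15T22:57Z): Summit.Parity.GeneralizedHardyLittlewood.Theses.InverseSieveTuples.TupleElliott

/-! ## Card A — smooth-part Halász -/

/-- **SieveRangeHLE** (card `smooth-part-halasz`, first lemma; provable now).  For `f` multiplicative,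
`1`-bounded and *trivial on prime powers `p^k` with `p > N^ε`* ("sieve range"), the shift-uniform
correlation `∑_{n ≤ N} Λ(n) f(n+h)`, `1 ≤ h ≤ N`, is at most `η N` as soon as the distance of `f` from `1`
carried by the primes `p ≤ N^ε` NOT dividing the shift `h` is `≥ A₀(η)`; `ε = ε(η)` is chosen small so that
the smooth part of `n + h` exceeds `N^{1/2}` on a set of mass `< η/4`.  The exclusion `p ∤ h` is exactly the
shift-divisor correction forced by the refuter's witness `f = 1_{(·,P)=1}`, `h = P`. -/
def SieveRangeHLE : Prop :=
  ∀ η : ℝ, 0 < η → ∃ ε : ℝ, 0 < ε ∧ ∃ A₀ : ℝ, ∃ N₀ : ℕ, ∀ N : ℕ, N₀ ≤ N → ∀ h : ℕ, 1 ≤ h → h ≤ N →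
    ∀ f : ArithmeticFunction ℂ, f.IsMultiplicative → (∀ n, ‖f n‖ ≤ 1) →
      (∀ p k : ℕ, p.Prime → (N : ℝ) ^ ε < p → 1 ≤ k → f (p ^ k) = 1) →
      A₀ ≤ ∑ p ∈ (Nat.primesLE ⌊(N : ℝ) ^ ε⌋₊).filter (fun p => ¬ p ∣ h), (1 - (f p).re) / (p : ℝ) →
        ‖∑ n ∈ Finset.Icc 1 N, (ArithmeticFunction.vonMangoldt n : ℂ) * f (n + h)‖ ≤ η * N

/-- The `y`-smooth part of `m`: the product of the prime powers `p^k ∥ m` with `p ≤ y`. [folklore] -/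
noncomputable def smoothPart (y m : ℕ) : ℕ :=
  m.factorization.prod fun p k => if p ≤ y then p ^ k else 1

/-- **FibrewiseSieveRangeHLE₁ = BFL₁** (card `smooth-part-halasz`, transfer target `C⁺` at `t = 1`).
Write `n + h = s · ℓ` with `s` the `N^ε`-smooth part and `ℓ` the rough cofactor.  `SieveRangeHLE` says that
`∑_n Λ(n) a(s(n+h))` is small for `a` far from twisted characters on the small primes not dividing `h`;
the transfer target demands the same FIBRE BY FIBRE over the rough cofactor `ℓ` (an `ℓ¹`-dispersion, i.e. a
Type-II statement with a completely factorable short variable).  One line gives HLE₁ from it: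
`∑_n Λ(n) f(n+h) = ∑_ℓ f(ℓ) ∑_{ℓ(n+h)=ℓ} Λ(n) f(s(n+h))`, and `|f(ℓ)| ≤ 1`. -/
def FibrewiseSieveRangeHLE1 : Prop :=
  ∀ η : ℝ, 0 < η → ∃ ε : ℝ, 0 < ε ∧ ∃ A₀ : ℝ, ∃ N₀ : ℕ, ∀ N : ℕ, N₀ ≤ N → ∀ h : ℕ, 1 ≤ h → h ≤ N →
    ∀ a : ArithmeticFunction ℂ, a.IsMultiplicative → (∀ n, ‖a n‖ ≤ 1) →
      (∀ (q : ℕ) (χ : DirichletCharacter ℂ q) (τ : ℝ), 1 ≤ q → (q : ℝ) ≤ A₀ → |τ| ≤ N →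
        A₀ ≤ ∑ p ∈ (Nat.primesLE ⌊(N : ℝ) ^ ε⌋₊).filter (fun p => ¬ p ∣ h),
          (1 - (a p * (starRingEnd ℂ) (Literature.NumberTheory.Sieve.twistedChar χ τ p))).re / (p : ℝ)) →
      let y : ℕ := ⌊(N : ℝ) ^ ε⌋₊
      ∑ ℓ ∈ Finset.Icc 1 (2 * N),
          ‖∑ n ∈ (Finset.Icc 1 N).filter (fun n => (n + h) / smoothPart y (n + h) = ℓ),
              (ArithmeticFunction.vonMangoldt n : ℂ) * a (smoothPart y (n + h))‖ ≤ η * N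

/-! ## Card C — relative Kátai / Cramér indistinguishability -/

/-- **RelativeBlockKatai** (card `relative-katai-cramer`, first lemma; provable now — the
Kátai–Bourgain–Sarnak–Ziegler criterion of the tree (`Konieczny.katai_fixed_length`) run blockwise and
relative to a majorant `ν`): if `F` is dominated by a weight `ν` of bounded mass with crude divisor bounds
and Turán–Kubilius concentration for the window of primes `(P₁, P₂]`, and the *block* bilinear sums
`∑_m F(pm) conj F(p'm)` over `p ≠ p'` in each dyadic block have relative size `≤ c`, then `F` is orthogonal
to every `1`-bounded multiplicative `f` at precision `η`.  No pretentiousness hypothesis on `f`. -/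
def RelativeBlockKatai : Prop :=
  ∀ B η : ℝ, 1 ≤ B → 0 < η → ∃ L₀ C c : ℝ, 0 < c ∧ ∀ N P₁ P₂ : ℕ, 2 ≤ N → P₁ < P₂ →
    C * Real.log N ≤ P₁ → ((P₂ : ℝ)) ^ 5 ≤ N →
    ∀ (F : ℕ → ℂ) (ν : ℕ → ℝ),
    let 𝓟 : Finset ℕ := (Nat.primesLE P₂).filter (fun p => P₁ < p)
    let L : ℝ := ∑ p ∈ 𝓟, (1 / p : ℝ)
    L₀ ≤ L →
    (∀ n, ‖F n‖ ≤ ν n) →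
    (∑ n ∈ range N, ν n ≤ B * N) →
    (∀ d : ℕ, 1 ≤ d → ∑ n ∈ (range N).filter (fun n => d ∣ n), ν n ≤ B * ((N : ℝ) / d + 1) * Real.log N) →
    (∑ n ∈ range N, ν n * ((#(𝓟.filter (· ∣ n)) : ℝ) - L) ^ 2 ≤ B * L * N) →
    (∀ P : ℕ, 1 ≤ P → ∑ p ∈ 𝓟.filter (fun p => P < p ∧ p ≤ 2 * P),
        ∑ m ∈ (range N).filter (fun m => p * m < N), ν (p * m) ^ 2 ≤ B * N * Real.log N / Real.log (2 * P)) →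
    (∀ P : ℕ, 1 ≤ P → ∑ p ∈ 𝓟.filter (fun p => P < p ∧ p ≤ 2 * P),
        ∑ p' ∈ 𝓟.filter (fun p' => P < p' ∧ p' ≤ 2 * P ∧ p' ≠ p),
          ‖∑ m ∈ (range N).filter (fun m => p * m < N ∧ p' * m < N), F (p * m) * (starRingEnd ℂ) (F (p' * m))‖
            ≤ c * N * P / Real.log (2 * P) ^ 2) →
    ∀ f : ArithmeticFunction ℂ, f.IsMultiplicative → (∀ n, ‖f n‖ ≤ 1) →
      ‖∑ n ∈ range N, F n * f n‖ ≤ η * N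

/-- Cramér model of level `Q`: `Λ_Q(m) = (P/φ(P))·1_{(m,P)=1}` with `P = Q#`. [folklore] -/
noncomputable def cramerLambda (Q m : ℕ) : ℝ :=
  if Nat.Coprime m (primorial Q) then (primorial Q : ℝ) / (Nat.totient (primorial Q) : ℝ) else 0

/-- **BlockPairDefect** (card `relative-katai-cramer`, the residual at `t = 1`, bounded shift `h`): the
doubled Hardy–Littlewood defect of the two-coefficient pair systems `(pm + h, p'm + h)` against the Cramér
model, on `ℓ¹`-average over `p ≠ p'` in each dyadic block of a polylog window, is `≤ c` in relative size,
for every `c > 0` once `Q ≥ Q₀(h, c)`. Two-sided version of KataiPropagation's `BlockPairExcess`. -/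
def BlockPairDefect : Prop :=
  ∀ h : ℕ, 1 ≤ h → ∀ c : ℝ, 0 < c → ∃ Q₀ : ℕ, ∀ Q : ℕ, Q₀ ≤ Q → ∃ C : ℝ, ∃ N₀ : ℕ, ∀ N : ℕ, N₀ ≤ N →
    ∀ P : ℕ, C * Real.log N ≤ P → (P : ℝ) ≤ Real.exp (Real.sqrt (Real.log N)) →
      ∑ p ∈ (Nat.primesLE (2 * P)).filter (fun p => P < p),
        ∑ p' ∈ (Nat.primesLE (2 * P)).filter (fun p' => P < p' ∧ p' ≠ p),
          |∑ m ∈ Finset.Icc 1 (N / P),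
              (ArithmeticFunction.vonMangoldt (p * m + h) - cramerLambda Q (p * m + h)) *
              (ArithmeticFunction.vonMangoldt (p' * m + h) - cramerLambda Q (p' * m + h))|
        ≤ c * N * P / Real.log (2 * P) ^ 2

/-- **CramerIndistinguishability₁** (card `relative-katai-cramer`, transfer target `C⁺` at `t = 1`, bounded
shifts): NO multiplicative observable distinguishes shifted primes from their Cramér model — for every
`1`-bounded multiplicative `f` (pretentious or not); written on the line `k = n − h` (`F(k) = (Λ − Λ_Q)(k+h)`,
matching `BlockPairDefect`'s dilations `F(pm) = (Λ − Λ_Q)(pm+h)`). HLE₁ follows by evaluating the model side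
(Halász in progressions to `Q`-smooth moduli). -/
def CramerIndistinguishability1 : Prop :=
  ∀ h : ℕ, 1 ≤ h → ∀ η : ℝ, 0 < η → ∃ Q₀ : ℕ, ∀ Q : ℕ, Q₀ ≤ Q → ∃ N₀ : ℕ, ∀ N : ℕ, N₀ ≤ N →
    ∀ f : ArithmeticFunction ℂ, f.IsMultiplicative → (∀ n, ‖f n‖ ≤ 1) →
      ‖∑ k ∈ Finset.Icc 1 N,
          ((ArithmeticFunction.vonMangoldt (k + h) - cramerLambda Q (k + h) : ℝ) : ℂ) * f k‖ ≤ η * N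

/-! ## Card B — decompose the primes, keep `f`: shifted-table Elliott -/

/-- **TableElliott** (card `table-elliott`, transfer target at `t = 1`): a uniformly non-pretentious `f` is
not near rank one on the shifted multiplication table `(f(mk+h))_{m ∼ M, k ≤ N/M}`, `M = N^θ`,
`θ ∈ [1/3, 1/2]`: the pair correlations along `(mk+h, m'k+h)` are `o(K)` on `ℓ¹`-average over `(m, m')`. -/
def TableElliott : Prop :=
  ∀ h : ℕ, 1 ≤ h → ∀ η θ : ℝ, 0 < η → 1 / 3 ≤ θ → θ ≤ 1 / 2 → ∃ A₀ : ℝ, ∃ N₀ : ℕ, ∀ N : ℕ, N₀ ≤ N →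
    ∀ f : ArithmeticFunction ℂ, f.IsMultiplicative → (∀ n, ‖f n‖ ≤ 1) →
      (∀ (q : ℕ) (χ : DirichletCharacter ℂ q) (τ : ℝ), 1 ≤ q → (q : ℝ) ≤ A₀ → |τ| ≤ N →
          A₀ ≤ Literature.NumberTheory.Sieve.pretentiousDistSq (⇑f)
            (Literature.NumberTheory.Sieve.twistedChar χ τ) N) →
      let M : ℕ := ⌊(N : ℝ) ^ θ⌋₊
      let K : ℕ := N / M
      ∑ m ∈ Finset.Icc M (2 * M), ∑ m' ∈ Finset.Icc M (2 * M),
          ‖∑ k ∈ Finset.Icc 1 K, f (m * k + h) * (starRingEnd ℂ) (f (m' * k + h))‖ ≤ η * (M : ℝ) ^ 2 * K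

end Summit.Parity.GeneralizedHardyLittlewood.Cruxes.TupleElliott.Sketch
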